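import Summits.QuantumFields.BalabanUV.Beta.GAN24.RespStepBm
import Summits.QuantumFields.BalabanUV.Beta.AxialDressingRootedBmDress
import Summits.QuantumFields.BalabanUV.Beta.GAN24.CoProjBmDivFree
import Summits.QuantumFields.BalabanUV.Beta.GAN24.E3SlotDivergence

/-!
# `BalabanUV.Beta.GAN24.TableSlotCoDress` — binder row G-an2-4 ∕ (CONV-C), W-slot CT-W, route «WC-TL» ∕ «QR-LL», row **(LT) «LAYER TRANSPORT»**, K-LL-4 (the three
# one-gauge cells of the DRESSED chain; leaf-01 g66 R-1, journal l.43776, Q-66-2): **THE DRESSED TABLE LEG IS THE UNDRESSED TABLE LEG ON THE SLOT-CO-DRESSED LETTER** —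
# the owner's answer to Q-66-2, part (i) (RULING R-gan24p1-g29-1): the Π_bm-window on the fine bond of the table leg (`RespStepBm.bmW`) MOVES ONTO THE LETTER's SLOT as
# an2's block-mean bond co-projector `coProjBmAtK` (entrywise `Πᵀ_bm`), for ARBITRARY kernel legs; the located class laws of the co-dressed letter are then BY NAME
# (`D1BFx.CoProjBmDivergence.divV_coProjBmAtK`: its slot divergence is the BLOCK AVERAGE of the letter's; `AxialDressingRooted.locStencil_coProjBmAtK`: same rate,
# constant `cKb'`) and the one-gauge table cell of K-LL-4 is, exactly, the undressed push of the DIFFERENCE letter `coProjBmAtK ρ N S − S` (row owner `b2b-balaban-gan24-p1`, gen 29)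

NOT IN PRINT; OUR BOOKKEEPING ([folklore] an2's windowed adjunction `AxialDressingRooted.sum_tsum_mul_coProjBmAt` (`Σ A·Πᵀ_bm g = Σ (coProjBmW A)·g`) read inside leaf-17's
table vertex `Push4.vertexW` and leaf-01's three-leg carrier `Push3.push₃`; the literal instance through leaf-01's `RespStepBm.respStepBm = bmW ∘ respStep` and leaf-12's
`RespStepSemigroup.colH_KStepUnit`; 0 cited facts, 0 `def`, 0 `def … : Prop`, 0 sorry).  HONEST FRAMING (cell contract, verbatim): «discharging `BetaPertH` makes Bałaban's UV
stability UNCONDITIONAL — a real constructive-QFT result; it is NOT the continuum limit and NOT the Clay problem.»  HONEST DEPENDENCY (verbatim): «continuum YM on T⁴ ⇐ BetaPertH ∧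
nine spine estimates (0/9 proved); BetaPertH ⇐ (D1) ∧ (D4) ∧ CAP+tail; G-an2-4 gates asym, D1 and NE2/3/4.»

WHY.  The END `WardRemainderEndThreeSplit.wLocStencil_unitS_split_three` (p329621 ✓) displays ONE layer bound `hLT` per sub-letter for the cubic push through the DRESSED chain
`legChain (respStepBmSeq ρ Lc)`; leaf-01's socket splits `T = U + G` into the pure cell and three one-gauge cells, and the cell with the gauge TABLE leg is power-divergent by
absolute count at the crossing bonds (KLL4-CELLS v1).  The identity below re-bases the table leg EXACTLY: the dressed table leg acting on `S` IS the undressed table leg acting on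
`coProjBmAtK ρ N S` — so every statement about the dressed table-slot push is a statement about the CLASS of the slot-co-dressed letter (its localisation: by name; its slot
divergence: the block average of `S`'s, by name; its slot charge: the block-flux dipole of `S` — engine E31 of the owner, kit j163884 ∕ j163889), and the one-gauge table cell
is the undressed push of `coProjBmAtK ρ N S − S`, which VANISHES for slot-divergence-free letters whose co-dressing is trivial.  Discharges NOTHING of K-LL-4 ∕ (LT) ∕ (Q-R) by
itself; asserts NO size.

WHAT (generic `d`, window blocking `N ≥ 1`, in-block root `toSite r`).
§1 **`vertexW_bmW_eq`** — `vertexW (bmW (toSite r) N w) S μ y x z a b = vertexW w (coProjBmAtK (toSite r) N S) μ y x z a b` for a table leg with summable fine rows at `(μ, y)`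
   and a letter bounded at the entry `(x, z, a, b)`; **`vertexW_bmW_eq_of_legDecay`** — the family form under `LegDecay w M C m` (`0 < m`) and `LocStencil S Cs δ` (`0 ≤ δ`).
§2 **`push₃_bmW_table_eq`** — `push₃ l r (bmW (toSite r) N w) S = push₃ l r w (coProjBmAtK (toSite r) N S)` for ARBITRARY kernel legs `l, r` (the kernel legs never see
   the table window); **`push₃_bmW_table_sub`** — the one-gauge TABLE cell: `push₃ l r (bmW (toSite r) N w − w) S κ′ u′ = push₃ l r w (coProjBmAtK (toSite r) N S) κ′ u′ −
   push₃ l r w S κ′ u′` on the class (via leaf-01's `Push3.push₃_sub`-free route: both sides are the same finite-sum bookkeeping of §1).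
§3 THE LITERAL's ONE-STEP TABLE LEG: **`push₃_respStepBm_table_eq`** — `push₃ l r (respStepBm (toSite rr) Lc (Lc^j) (Lc^(j+1))) S = push₃ l r (respStep (Lc^j) (Lc^(j+1)))
   (coProjBmAtK (toSite rr) Lc S)` under `Decays (KStepUnit Lc j) C m` (`0 < m`), `1 ≤ Lc`, in-block root, `LocStencil S Cs δ`.
§4 ON SLOT-DIVERGENCE-FREE LETTERS THE DRESSED TABLE LEG IS INVISIBLE (leaf-02 g51's `CoProjBmDivFree.coProjBmAtK_eq_self_of_divFree` BY NAME — div-free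
   slots are FIXED by the co-dressing): **`push₃_bmW_table_eq_of_divFree`**, **`push₃_respStepBm_table_eq_of_divFree`** — `push₃ l r (respStepBm ρ Lc …) S = push₃ l r (respStep …) S`
   whenever `Σ_β (S β p − S β (p − e_β)) = 0` at every site: the one-gauge TABLE cell of K-LL-4 is then ABSENT, for arbitrary kernel legs (RULING R-gan24p1-g29-1 (A)(v)).
§5 (v1.2) CO-CLOSEDNESS PROPAGATES ALONG THE DRESSED S-STEP (leaf-03's T-EQ law `E3SlotDivergence.divV_e3OfK_comb` at ZERO block flux): **`mmRead_zero`**,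
   **`divV_e3OfK_comb_eq_zero_of_fluxFree`** (a FLUX-FREE bounded letter's S-step image `e3OfK Lc K♮ᴱ_j S` is slot-divergence-free), **`divV_e3OfK_comb_eq_zero_of_divFree`**
   (a slot-divergence-free letter's image is slot-divergence-free) — with §4 the induction step of the (Q-R)^{cc} route: once co-closed, the letter never sees the table dressing again.
[folklore]; 0 cited facts, 0 `def`, 0 `def … : Prop`, 0 sorry.  Asserts NOTHING about the size of any cell, NOTHING about which σ-letters are slot-divergence-free; NOTHING of
(Q-R) ∕ (LT) ∕ (LAY) ∕ (S) ∕ «T2Shape» ∕ «T2Drift» ∕ (hW, hWall) discharged; NEVER «G-an2-4 closed» as (CONV-C); NOT D1, NOT `BetaPertH`, NOT continuum, NOT Clay.  2026-08-22; no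
existing file touched.
-/

noncomputable section

open Finset
open scoped BigOperators
open Literature.MathematicalPhysics.QuantumFieldTheory
open Literature.MathematicalPhysics.QuantumFieldTheory.Balaban1983to89
open Literature.MathematicalPhysics.QuantumFieldTheory.Balaban1983to89.Beta
open ExpKernelCalculus (MKer Decays)
open AffineAveraging (box toSite unitVec)
open OneStepResolventKernel (Fib LocStencil)
open BalabanCompositeJets (respStep)
open Summit.QuantumFields.BalabanUV.Beta.AxialDressingRooted (coProjBmAt coProjBmW coProjBmAtK coProjBmAtK_eval sum_tsum_mul_coProjBmAt)
open Summit.QuantumFields.BalabanUV.Beta.ChartConjugationReflection (abs_le_of_locStencil)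
open Summit.QuantumFields.BalabanUV.Beta.GAN24.CombesThomas (KStepUnit)
open Summit.QuantumFields.BalabanUV.Beta.GAN24.Push4 (vertexW vertexW_apply Lk Rk ffRead)
open Summit.QuantumFields.BalabanUV.Beta.GAN24.Push4Bounds (LegDecay LegDecay.summable legDecay_colH)
open Summit.QuantumFields.BalabanUV.Beta.GAN24.Push3 (push₃)
open Summit.QuantumFields.BalabanUV.Beta.GAN24.RespStepSemigroup (colH_KStepUnit)
open Summit.QuantumFields.BalabanUV.Beta.GAN24.RespStepBm (bmW bmW_apply respStepBm respStepBm_def)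
open Summit.QuantumFields.BalabanUV.Beta.GAN24.CoProjBmDivFree (coProjBmAtK_eq_self_of_divFree)
open OneStepKernelFamily (KInvStep)
open BalabanStepJetsSucc (mmRead)
open KernelWard (divV)
open Summit.QuantumFields.BalabanUV.Beta.SpineRooted (e3OfK)
open Summit.QuantumFields.BalabanUV.Beta.HessKerDressedUnits (unitK)
open Summit.QuantumFields.BalabanUV.Beta.GAN24.CombesThomas (sfStep smStep)
open Summit.QuantumFields.BalabanUV.Beta.AxialDressingRooted (coDressKBmAt)
open Summit.QuantumFields.BalabanUV.Beta.GAN24.E3SlotDivergence (divV_e3OfK_comb)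
open Summit.QuantumFields.BalabanUV.Beta.KernelWardRelative (comp_zero_left)
open Literature.MathematicalPhysics.QuantumFieldTheory.Balaban1983to89.Beta.StepDriftWitness (comp_zero_right)

namespace Summit.QuantumFields.BalabanUV.Beta.GAN24.TableSlotCoDress

variable {d : ℕ}

/-! ## §1 The table vertex: the window moves from the leg onto the letter's slot -/

/-- [folklore] **THE DRESSED TABLE LEG IS THE UNDRESSED TABLE LEG ON THE SLOT-CO-DRESSED LETTER** (one entry): for a table leg `w` whose fine rows at the coarse bond
`(μ, y)` are summable and a letter `S` bounded at the kernel entry `(x, z, a, b)`,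
`vertexW (bmW ρ N w) S μ y x z a b = vertexW w (coProjBmAtK ρ N S) μ y x z a b` — an2's windowed adjunction `sum_tsum_mul_coProjBmAt` read inside leaf-17's `vertexW`. -/
theorem vertexW_bmW_eq {N : ℕ} (hN : 1 ≤ N) {r : Fin (d + 1) → ℕ} (hr : r ∈ box (d + 1) N)
    {w : Fin (d + 1) → (Fin (d + 1) → ℤ) → Fin (d + 1) → (Fin (d + 1) → ℤ) → ℝ}
    {S : Fin (d + 1) → (Fin (d + 1) → ℤ) → MKer (d + 1) (Fib d)}
    (μ : Fin (d + 1)) (y : Fin (d + 1) → ℤ) (hw : ∀ κ, Summable (w μ y κ))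
    (x z : Fin (d + 1) → ℤ) (a b : Fib d) {M : ℝ} (hS : ∀ κ u, |S κ u x z a b| ≤ M) :
    vertexW (bmW (toSite r) N w) S μ y x z a b = vertexW w (coProjBmAtK (toSite r) N S) μ y x z a b := by
  rw [vertexW_apply, vertexW_apply]
  have h := sum_tsum_mul_coProjBmAt hN hr (A := w μ y) (g := fun κ u => S κ u x z a b) hw hS
  -- left: the window on the leg; right: the window on the letter's slot
  have eL : (∑ κ' : Fin (d + 1), ∑' u', bmW (toSite r) N w μ y κ' u' * S κ' u' x z a b)
      = ∑ κ' : Fin (d + 1), ∑' u', coProjBmW (toSite r) N (w μ y) κ' u' * S κ' u' x z a b := rfl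
  have eR : (∑ κ : Fin (d + 1), ∑' u, w μ y κ u * coProjBmAtK (toSite r) N S κ u x z a b)
      = ∑ κ : Fin (d + 1), ∑' u, w μ y κ u * coProjBmAt (toSite r) N (fun κ' u' => S κ' u' x z a b) κ u := rfl
  rw [eL, eR, h]

/-- [folklore] **THE SAME ON THE CLASS**: a localised table leg (`LegDecay w M C m`, `0 < m`) and a local letter (`LocStencil S Cs δ`, `0 ≤ δ`) ⟹
`vertexW (bmW ρ N w) S = vertexW w (coProjBmAtK ρ N S)` as families. -/
theorem vertexW_bmW_eq_of_legDecay {N : ℕ} (hN : 1 ≤ N) {r : Fin (d + 1) → ℕ} (hr : r ∈ box (d + 1) N)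
    {w : Fin (d + 1) → (Fin (d + 1) → ℤ) → Fin (d + 1) → (Fin (d + 1) → ℤ) → ℝ} {M : ℕ} {C m : ℝ} (hw : LegDecay w M C m) (hm : 0 < m)
    {S : Fin (d + 1) → (Fin (d + 1) → ℤ) → MKer (d + 1) (Fib d)} {Cs δ : ℝ} (hS : LocStencil S Cs δ) (hδ : 0 ≤ δ) :
    vertexW (bmW (toSite r) N w) S = vertexW w (coProjBmAtK (toSite r) N S) := by
  funext μ y x z a b
  exact vertexW_bmW_eq hN hr μ y (fun κ => hw.summable hm μ y κ) x z a b (fun κ u => abs_le_of_locStencil hS hδ κ u x z a b)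

/-! ## §2 The three-leg push: arbitrary kernel legs -/

/-- [folklore] **THE THREE-LEG PUSH WITH A WINDOWED TABLE LEG** = the push with the undressed table leg of the slot-co-dressed letter, for ARBITRARY kernel legs `l, r`:
`push₃ l r (bmW ρ N w) S = push₃ l r w (coProjBmAtK ρ N S)` (the kernel legs never see the table window). -/
theorem push₃_bmW_table_eq {N : ℕ} (hN : 1 ≤ N) {r : Fin (d + 1) → ℕ} (hr : r ∈ box (d + 1) N)
    (l rk : Fin (d + 1) → (Fin (d + 1) → ℤ) → Fin (d + 1) → (Fin (d + 1) → ℤ) → ℝ)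
    {w : Fin (d + 1) → (Fin (d + 1) → ℤ) → Fin (d + 1) → (Fin (d + 1) → ℤ) → ℝ} {M : ℕ} {C m : ℝ} (hw : LegDecay w M C m) (hm : 0 < m)
    {S : Fin (d + 1) → (Fin (d + 1) → ℤ) → MKer (d + 1) (Fib d)} {Cs δ : ℝ} (hS : LocStencil S Cs δ) (hδ : 0 ≤ δ) :
    push₃ l rk (bmW (toSite r) N w) S = push₃ l rk w (coProjBmAtK (toSite r) N S) := by
  funext κ' u'
  unfold push₃
  rw [vertexW_bmW_eq_of_legDecay hN hr hw hm hS hδ]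

/-- [folklore] **THE ONE-GAUGE TABLE CELL IS THE UNDRESSED PUSH OF THE DIFFERENCE LETTER**, entrywise: for arbitrary kernel legs `l, r`,
`push₃ l r (bmW ρ N w) S κ′ u′ x z a b − push₃ l r w S κ′ u′ x z a b = push₃ l r w (coProjBmAtK ρ N S) κ′ u′ x z a b − push₃ l r w S κ′ u′ x z a b`
(the K-LL-4 table cell of `LayerTransportCells.biLoc_smul_push₃_of_telescope` in the letter-side currency; no additivity-on-a-class hypothesis is needed for this
restatement — the difference is taken AFTER the push). -/
theorem push₃_bmW_table_sub {N : ℕ} (hN : 1 ≤ N) {r : Fin (d + 1) → ℕ} (hr : r ∈ box (d + 1) N)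
    (l rk : Fin (d + 1) → (Fin (d + 1) → ℤ) → Fin (d + 1) → (Fin (d + 1) → ℤ) → ℝ)
    {w : Fin (d + 1) → (Fin (d + 1) → ℤ) → Fin (d + 1) → (Fin (d + 1) → ℤ) → ℝ} {M : ℕ} {C m : ℝ} (hw : LegDecay w M C m) (hm : 0 < m)
    {S : Fin (d + 1) → (Fin (d + 1) → ℤ) → MKer (d + 1) (Fib d)} {Cs δ : ℝ} (hS : LocStencil S Cs δ) (hδ : 0 ≤ δ)
    (κ' : Fin (d + 1)) (u' x z : Fin (d + 1) → ℤ) (a b : Fib d) :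
    push₃ l rk (bmW (toSite r) N w) S κ' u' x z a b - push₃ l rk w S κ' u' x z a b
      = push₃ l rk w (coProjBmAtK (toSite r) N S) κ' u' x z a b - push₃ l rk w S κ' u' x z a b := by
  rw [push₃_bmW_table_eq hN hr l rk hw hm hS hδ]

/-! ## §3 The literal's one-step table leg -/

/-- [folklore] **THE LITERAL's DRESSED ONE-STEP TABLE LEG RE-BASED**: for the Π_bm-dressed response family of the normalised step resolvent `K̃_j = KStepUnit Lc j`
(`RespStepBm.respStepBm ρ Lc (Lc^j) (Lc^(j+1)) = bmW ρ Lc (respStep (Lc^j) (Lc^(j+1)))`, the table ∕ column legs of `colH (coDressKBmAt ρ Lc K̃_j)`), any kernel legs `l, r`,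
a decaying `K̃_j` and a local letter `S`:
`push₃ l r (respStepBm ρ Lc (Lc^j) (Lc^(j+1))) S = push₃ l r (respStep (Lc^j) (Lc^(j+1))) (coProjBmAtK ρ Lc S)`. -/
theorem push₃_respStepBm_table_eq {Lc : ℕ} [NeZero Lc] (hLc : 1 ≤ Lc) {rr : Fin (d + 1) → ℕ} (hrr : rr ∈ box (d + 1) Lc)
    (l rk : Fin (d + 1) → (Fin (d + 1) → ℤ) → Fin (d + 1) → (Fin (d + 1) → ℤ) → ℝ)
    {j : ℕ} {C m : ℝ} (hK : Decays (KStepUnit (d := d) Lc j) C m) (hm : 0 < m)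
    {S : Fin (d + 1) → (Fin (d + 1) → ℤ) → MKer (d + 1) (Fib d)} {Cs δ : ℝ} (hS : LocStencil S Cs δ) (hδ : 0 ≤ δ) :
    push₃ l rk (respStepBm (toSite rr) Lc (Lc ^ j) (Lc ^ (j + 1))) S
      = push₃ l rk (respStep (d := d) (Lc ^ j) (Lc ^ (j + 1))) (coProjBmAtK (toSite rr) Lc S) := by
  have hw : LegDecay (respStep (d := d) (Lc ^ j) (Lc ^ (j + 1))) Lc C m := by
    rw [← colH_KStepUnit]; exact legDecay_colH hK
  rw [respStepBm_def]
  exact push₃_bmW_table_eq hLc hrr l rk hw hm hS hδ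

/-! ## §4 Slot-divergence-free letters: the dressed table leg is invisible -/

/-- [folklore] **ON A SLOT-DIVERGENCE-FREE LETTER THE WINDOWED TABLE LEG IS THE BARE TABLE LEG**: for ARBITRARY kernel legs `l, r`, a localised table leg `w` and a local letter `S` whose
slot divergence vanishes at every site (`Σ_β (S β p − S β (p − e_β)) = 0`), `push₃ l r (bmW ρ N w) S = push₃ l r w S` — §2 and leaf-02's `coProjBmAtK_eq_self_of_divFree`. -/
theorem push₃_bmW_table_eq_of_divFree {N : ℕ} (hN : 1 ≤ N) {r : Fin (d + 1) → ℕ} (hr : r ∈ box (d + 1) N)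
    (l rk : Fin (d + 1) → (Fin (d + 1) → ℤ) → Fin (d + 1) → (Fin (d + 1) → ℤ) → ℝ)
    {w : Fin (d + 1) → (Fin (d + 1) → ℤ) → Fin (d + 1) → (Fin (d + 1) → ℤ) → ℝ} {M : ℕ} {C m : ℝ} (hw : LegDecay w M C m) (hm : 0 < m)
    {S : Fin (d + 1) → (Fin (d + 1) → ℤ) → MKer (d + 1) (Fib d)} {Cs δ : ℝ} (hS : LocStencil S Cs δ) (hδ : 0 ≤ δ)
    (hdiv : ∀ (p x y : Fin (d + 1) → ℤ) (a b : Fib d), ∑ β : Fin (d + 1), (S β p x y a b - S β (p - unitVec β) x y a b) = 0) :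
    push₃ l rk (bmW (toSite r) N w) S = push₃ l rk w S := by
  rw [push₃_bmW_table_eq hN hr l rk hw hm hS hδ, coProjBmAtK_eq_self_of_divFree hN hr hdiv]

/-- [folklore] **THE LITERAL's DRESSED ONE-STEP TABLE LEG IS INVISIBLE ON SLOT-DIVERGENCE-FREE LETTERS**: for arbitrary kernel legs `l, r`, a decaying `K̃_j` and a local letter `S`
with vanishing slot divergence, `push₃ l r (respStepBm ρ Lc (Lc^j) (Lc^(j+1))) S = push₃ l r (respStep (Lc^j) (Lc^(j+1))) S` — the one-gauge TABLE cell of K-LL-4 is ABSENT on such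
letters (RULING R-gan24p1-g29-1 (A)(v); engine E31: the (β) piece, `Δ = 1e-18`). -/
theorem push₃_respStepBm_table_eq_of_divFree {Lc : ℕ} [NeZero Lc] (hLc : 1 ≤ Lc) {rr : Fin (d + 1) → ℕ} (hrr : rr ∈ box (d + 1) Lc)
    (l rk : Fin (d + 1) → (Fin (d + 1) → ℤ) → Fin (d + 1) → (Fin (d + 1) → ℤ) → ℝ)
    {j : ℕ} {C m : ℝ} (hK : Decays (KStepUnit (d := d) Lc j) C m) (hm : 0 < m)
    {S : Fin (d + 1) → (Fin (d + 1) → ℤ) → MKer (d + 1) (Fib d)} {Cs δ : ℝ} (hS : LocStencil S Cs δ) (hδ : 0 ≤ δ)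
    (hdiv : ∀ (p x y : Fin (d + 1) → ℤ) (a b : Fib d), ∑ β : Fin (d + 1), (S β p x y a b - S β (p - unitVec β) x y a b) = 0) :
    push₃ l rk (respStepBm (toSite rr) Lc (Lc ^ j) (Lc ^ (j + 1))) S
      = push₃ l rk (respStep (d := d) (Lc ^ j) (Lc ^ (j + 1))) S := by
  rw [push₃_respStepBm_table_eq hLc hrr l rk hK hm hS hδ, coProjBmAtK_eq_self_of_divFree hLc hrr hdiv]

/-! ## §5 Co-closedness propagates along the dressed S-step (v1.2) -/

/-- [folklore] The `mm`-read of the zero kernel is zero. -/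
theorem mmRead_zero (M : ℕ) : mmRead (d := d) M (0 : MKer (d + 1) (Fib d)) = 0 := by
  funext x z a b
  cases a <;> cases b <;> simp [mmRead]

/-- [folklore] **A FLUX-FREE LETTER's S-STEP IMAGE IS SLOT-DIVERGENCE-FREE** (the law (L2) of RULING R-gan24p1-g29-1 = leaf-03's T-EQ `E3SlotDivergence.divV_e3OfK_comb`, at
ZERO block flux; in-block root, `[NeZero Lc]`): if every block flux `Σ_{v∈box} divV S (Lc•y + toSite v)` of a bounded letter `S` vanishes, then the literal's S-step image
`e3OfK Lc K♮ᴱ_j S` (`K♮ᴱ_j = unitK (sfStep Lc j) (smStep d Lc j) (coDressKBmAt ρ Lc (KInvStep Lc j))`) has `divV (e3OfK Lc K♮ᴱ_j S) y = 0` at every `y` — the engine's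
«interior labels push to EXACTLY co-closed letters» (E31: 8.7e-15). -/
theorem divV_e3OfK_comb_eq_zero_of_fluxFree {Lc : ℕ} [NeZero Lc] {r : Fin (d + 1) → ℕ} (hr : r ∈ box (d + 1) Lc) (j : ℕ)
    {S : Fin (d + 1) → (Fin (d + 1) → ℤ) → MKer (d + 1) (Fib d)} {B : ℝ} (hS : ∀ κ u x z a b, |S κ u x z a b| ≤ B)
    (hflux : ∀ y : Fin (d + 1) → ℤ, ∑ v ∈ box (d + 1) Lc, divV S ((Lc : ℤ) • y + toSite v) = 0) (y : Fin (d + 1) → ℤ) :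
    divV (e3OfK Lc (unitK (sfStep Lc j) (smStep d Lc j) (coDressKBmAt (toSite r) Lc (KInvStep (d := d) Lc j))) S) y = 0 := by
  rw [divV_e3OfK_comb hr j hS y, hflux y, comp_zero_right, comp_zero_left, mmRead_zero, smul_zero, neg_zero]

/-- [folklore] **CO-CLOSEDNESS PROPAGATES**: a slot-divergence-free bounded letter's S-step image through the literal's dressed step is slot-divergence-free (block sums of a
vanishing divergence vanish) — with §4 (`push₃_respStepBm_table_eq_of_divFree`) the induction step of the (Q-R)^{cc} route of RULING R-gan24p1-g29-1 (E): once co-closed,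
a letter never sees the table dressing again, at any later level. -/
theorem divV_e3OfK_comb_eq_zero_of_divFree {Lc : ℕ} [NeZero Lc] {r : Fin (d + 1) → ℕ} (hr : r ∈ box (d + 1) Lc) (j : ℕ)
    {S : Fin (d + 1) → (Fin (d + 1) → ℤ) → MKer (d + 1) (Fib d)} {B : ℝ} (hS : ∀ κ u x z a b, |S κ u x z a b| ≤ B)
    (hdiv : ∀ y : Fin (d + 1) → ℤ, divV S y = 0) (y : Fin (d + 1) → ℤ) :
    divV (e3OfK Lc (unitK (sfStep Lc j) (smStep d Lc j) (coDressKBmAt (toSite r) Lc (KInvStep (d := d) Lc j))) S) y = 0 :=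
  divV_e3OfK_comb_eq_zero_of_fluxFree hr j hS (fun _ => Finset.sum_eq_zero fun _ _ => hdiv _) y

end Summit.QuantumFields.BalabanUV.Beta.GAN24.TableSlotCoDress

end
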